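import Summits.QuantumFields.BalabanUV.T4Continuum.Support.AveragingDeficitKDatum
import Summits.QuantumFields.BalabanUV.T4Continuum.Support.AveragingDeficitDualResidual
import Summits.QuantumFields.BalabanUV.T4Continuum.Support.MinimalActionRate

/-!
# AveragingDeficitKDatumTorus (T⁴ programme, node NE3, row NE3-R2, gen 4) — THE K-DATUM ON THE PERIOD AND IN
# `Regular.grad` CURRENCY: local exponential gauges with the printed-TYPE sup radii `c₀/L^j`, `c₁/L^{2j}`, `c₂/L^{3j}`
# around every block of side `L^j` give `gradFluxSq V ([0, N·L^j)^d) ≤ kReg(d, N_c, c) · N^d · (L^j)^d / (L^j)^6`, hence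
# `MinimalActionRate.Regular d L N b (kReg …) j V` for unitary, periodic, small-field `V`

HONEST FRAMING (cell `pub-balaban`, T4-DAG PAGE 1; unit `b2b-balaban-t4-ne3r2-p1` = owner of BINDER-OWNERS row NE3-R2,
gen 4).  The cell's T4 target is the finite-torus continuum limit of the unit-scale averaged loop expectations — NOT
infinite volume, NO mass gap, NOT Clay, NOT summit progress.  DICTIONARY theorem (see `AveragingDeficitKDatum`): the
exponent `−6` of the slot `Regular.grad` («`Σ|∇_U F|² ≤ g N^d η^{6−d}`, the `ℓ²` form of `|∇_U F| ≲ ε₁η³`, (9)ˢᵘᵖ + (10) via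
interior `H²`») comes out of the cube theorem with cubes AND Caccioppoli collars of side `L^j`: the Laplacian term gives
`(c₂/L^{3j})²`, the collar term `(c₁/L^{2j})²/(L^j)²`, the remainder `kRem² ≤ (90c₀c₁ + 32c₁² + 360c₀³)²/L^{6j}`, and the
`N^d` cubes of `(4L^j+3)^d ≤ 7^d L^{jd}` fat sites each give the volume factor.  It does NOT assert that Bałaban's minimisers
admit such gauges (B11 Theorem 1, TYPE, asserted by nobody here); NE3 is NOT proved.

CONTENT (all [folklore], 0 sorry; no definitions — `kReg` is `AveragingDeficitKDatum.kReg`): §1 `sum_boxVec_le_box` (a block is covered by the cube of radius `B−1` at its base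
corner), **`gradFluxSq_period_le`** (`gradFluxSq V (periodBox (B·N)) ≤ N^d (2B+2M+3)^d kBox`, by
`T4AveragingDeficitWallBoundary.sum_blocks_eq` + `blockSites_periodBox` and the cube theorem; periodicity unused);
§2 `kBox_scaling_le`, **`gradFluxSq_period_le_scaling`** (the displayed bound), **`regular_of_expGauge`** (row
NE3's (H3) regularity SHAPE from unitary + periodic + small field + local exponential gauges), non-vacuity `regular_flat`.
DICTIONARY for this row's `AveragingDeficitDualResidual.dualResidual_torus`: its factor
`√(gradFluxSq V (blockSites L (periodBox M)))` is `√(gradFluxSq V (periodBox (L·M)))` (`blockSites_periodBox`), bounded by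
the square root of the displayed bound with `N·L^j := L·M`.
Context: T. Bałaban, Commun. Math. Phys. **102** (1985) 277–309 [Balaban1985Variational], Thm 1 (8)–(10) p. 279 («for an
arbitrary cube □ … of a size 2ML^jη … there exists a gauge transformation u defined on a neighborhood of □ and such that
on □ …»).  No printed sentence is a hypothesis.  PLACEMENT: `Summits/QuantumFields/BalabanUV/` (human rule 2026-08-19).
Record: HOME `t4/T4-EST-NE3-R2.md` v0.5.
-/

set_option autoImplicit false

open scoped BigOperators Matrix.Norms.L2Operator
open NormedSpace

namespace Summit.QuantumFields.BalabanUV.T4Continuum.AveragingDeficitKDatumTorus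

open Literature.MathematicalPhysics.QuantumFieldTheory.Balaban1983to89
open B7Prop1Explicit B7Prop2Explicit MatrixLog UnitaryModel
open T4AveragingDeficitWall hiding Site Plane Plaq Bond
open T4AveragingDeficitWallBoundary (IsPeriodicCfg periodBox blockSites_periodBox sum_blocks_eq card_periodBox)
open AveragingDeficitCounting (box_mono self_mem_box mem_box_iff card_box_eq smul_add_boxVec_mem_box)
open AveragingDeficitLatticeH2Prep (fd sd lap)
open AveragingDeficitKDatum (ExpGauge kBox kBox_nonneg gradFluxSq_box_le expGauge_flat kRem kRem_nonneg' kRem_le' kReg)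
open MinimalActionRate (Regular)
open AveragingDeficitResidualPairing (coarseActionOf)
open AveragingDeficitFaceLift (liftSmall)
open AveragingDeficitDerivWallProof (wallConst wallConst_nonneg)
open AveragingDeficitDualResidual (FineCritical dualC1 dualC2 coarseSq coarseL1 dualResidual_torus)

noncomputable section

variable {d : ℕ} {n : Type*} [Fintype n] [DecidableEq n]

/-! ## §1 Covering the period by cubes around the blocks -/

/-- A block is covered by the cube of radius `B − 1` around its base corner: the sum of a nonnegative function over the
`B^d` block sites `B•q + r` is at most its sum over `box (B−1) (B•q)`. [folklore] -/
theorem sum_boxVec_le_box (B : ℕ) (hB : 1 ≤ B) (q : Site d) {g : Site d → ℝ} (hg : ∀ x, 0 ≤ g x) :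
    ∑ r : Fin d → Fin B, g ((B : ℤ) • q + boxVec B r) ≤ ∑ x ∈ box (B - 1) ((B : ℤ) • q), g x := by
  classical
  have hinj : Set.InjOn (fun r : Fin d → Fin B => (B : ℤ) • q + boxVec B r) (Finset.univ : Finset (Fin d → Fin B)) := by
    intro r _ r' _ h
    have h' : boxVec B r = boxVec B r' := add_left_cancel h
    funext κ
    have := congr_fun h' κ
    exact Fin.ext (by simpa [boxVec] using this)
  rw [← Finset.sum_image hinj]
  refine Finset.sum_le_sum_of_subset_of_nonneg (fun x hx => ?_) fun x _ _ => hg x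
  obtain ⟨r, _, rfl⟩ := Finset.mem_image.mp hx
  exact smul_add_boxVec_mem_box B hB q r

/-- **THE K-DATUM ON THE PERIOD** (covering by the `N^d` cubes around the blocks of side `B`): for `U(N)`-valued `V`
admitting around EVERY block base corner `B•q` a local exponential gauge on `box (B+M+1) (B•q)` with sup radii
`α₀, α₁ ≤ 1/8`, `α₂`,
`gradFluxSq V ([0, B·N)^d) ≤ N^d · (2B+2M+3)^d · kBox d N_c M α₀ α₁ α₂` (`N_c` the matrix size).  Periodicity of `V` is
not used. [folklore] -/
theorem gradFluxSq_period_le [Nonempty n] {V : Site d → Fin d → (Matrix n n ℂ)ˣ} (hV : IsUnitaryCfg V) {B N M : ℕ} (hB : 1 ≤ B)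
    (hM : 1 ≤ M) {α₀ α₁ α₂ : ℝ} (hα₀ : 0 ≤ α₀) (hα₁ : 0 ≤ α₁) (hα₀' : α₀ ≤ 1 / 8) (hα₁' : α₁ ≤ 1 / 8)
    (hG : ∀ q : Site d, ExpGauge d V ((B : ℤ) • q) (B - 1 + M + 2) α₀ α₁ α₂) :
    gradFluxSq V (periodBox (B * N))
      ≤ (N : ℝ) ^ d * ((2 * (B - 1 + M + 2) + 1 : ℕ) : ℝ) ^ d * kBox d (Fintype.card n) M α₀ α₁ α₂ := by
  set g : Site d → ℝ := fun x => ∑ κ : Fin d, ∑ π : T4AveragingDeficitWall.Plane d, ‖covGrad V (flux V) x κ π‖ ^ 2 with hg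
  have hg0 : ∀ x, 0 ≤ g x := fun x => by positivity
  have hK := kBox_nonneg d (Fintype.card n) M α₀ α₁ α₂
  have e1 : gradFluxSq V (periodBox (B * N)) = ∑ x ∈ periodBox (B * N), g x := rfl
  rw [e1, ← blockSites_periodBox B N hB, ← sum_blocks_eq B hB (periodBox N) g]
  calc ∑ q ∈ periodBox N, ∑ r : Fin d → Fin B, g ((B : ℤ) • q + boxVec B r)
      ≤ ∑ q ∈ periodBox N, ∑ x ∈ box (B - 1) ((B : ℤ) • q), g x :=
        Finset.sum_le_sum fun q _ => sum_boxVec_le_box B hB q hg0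
    _ ≤ ∑ q ∈ periodBox N, ((box (B - 1 + M + 2) ((B : ℤ) • q)).card : ℝ) * kBox d (Fintype.card n) M α₀ α₁ α₂ :=
        Finset.sum_le_sum fun q _ => gradFluxSq_box_le hV hM hα₀ hα₁ hα₀' hα₁' (hG q)
    _ = (N : ℝ) ^ d * ((2 * (B - 1 + M + 2) + 1 : ℕ) : ℝ) ^ d * kBox d (Fintype.card n) M α₀ α₁ α₂ := by
        simp only [card_box_eq]
        rw [Finset.sum_const, card_periodBox, nsmul_eq_mul]
        push_cast
        ring

/-! ## §2 The scaling of B11 Theorem 1: radii `c₀/L^j`, `c₁/L^{2j}`, `c₂/L^{3j}`, cubes and collars of side `L^j` -/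

/-- The cube constant in the scaling regime: `kBox d N L^j (c₀/B) (c₁/B²) (c₂/B³) ≤ 7^{−d}·kReg/B⁶`, `B = L^j ≥ 1`.
[folklore] -/
theorem kBox_scaling_le (d N B : ℕ) (hB : 1 ≤ B) {c₀ c₁ c₂ : ℝ} (hc₀ : 0 ≤ c₀) (hc₀' : c₀ ≤ 1 / 8) (hc₁ : 0 ≤ c₁)
    (hc₁' : c₁ ≤ 1 / 8) :
    kBox d N B (c₀ / B) (c₁ / (B : ℝ) ^ 2) (c₂ / (B : ℝ) ^ 3)
      ≤ d * Fintype.card (T4AveragingDeficitWall.Plane d) * (16 * d * N * ((d + 1) * c₂ ^ 2 + d * (6 * d + 1) * c₁ ^ 2)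
        + 2 * (90 * c₀ * c₁ + 32 * c₁ ^ 2 + 360 * c₀ ^ 3) ^ 2) / (B : ℝ) ^ 6 := by
  have hB1 : (1 : ℝ) ≤ B := by exact_mod_cast hB
  have hB0 : (0 : ℝ) < B := by linarith
  set α₀ := c₀ / (B : ℝ) with hα₀
  set α₁ := c₁ / (B : ℝ) ^ 2 with hα₁
  have hα₀0 : 0 ≤ α₀ := by positivity
  have hα₁0 : 0 ≤ α₁ := by positivity
  have hα₀' : α₀ ≤ 1 / 8 := (div_le_self hc₀ hB1).trans hc₀'
  have hα₁' : α₁ ≤ 1 / 8 := (div_le_self hc₁ (one_le_pow₀ hB1)).trans hc₁'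
  set ρ := 90 * c₀ * c₁ + 32 * c₁ ^ 2 + 360 * c₀ ^ 3 with hρ
  have hρ0 : 0 ≤ ρ := by positivity
  -- the remainder in the scaling regime
  have hk : kRem α₀ α₁ ≤ ρ / (B : ℝ) ^ 3 := by
    refine (kRem_le' hα₀0 hα₁0 hα₀' hα₁').trans ?_
    have h1 : 32 * α₁ ^ 2 ≤ 32 * c₁ ^ 2 / (B : ℝ) ^ 3 := by
      rw [hα₁, div_pow, ← pow_mul, mul_div_assoc]
      refine mul_le_mul_of_nonneg_left (div_le_div_of_nonneg_left (sq_nonneg _) (by positivity)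
        (pow_le_pow_right₀ hB1 (by norm_num))) (by norm_num)
    have e2 : 90 * α₀ * α₁ = 90 * c₀ * c₁ / (B : ℝ) ^ 3 := by rw [hα₀, hα₁]; field_simp
    have e3 : 360 * α₀ ^ 3 = 360 * c₀ ^ 3 / (B : ℝ) ^ 3 := by rw [hα₀]; field_simp
    rw [e2, e3, hρ]
    have : 90 * c₀ * c₁ / (B : ℝ) ^ 3 + 32 * c₁ ^ 2 / (B : ℝ) ^ 3 + 360 * c₀ ^ 3 / (B : ℝ) ^ 3
        = (90 * c₀ * c₁ + 32 * c₁ ^ 2 + 360 * c₀ ^ 3) / (B : ℝ) ^ 3 := by field_simp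
    linarith
  have hk2 : kRem α₀ α₁ ^ 2 ≤ ρ ^ 2 / (B : ℝ) ^ 6 := by
    rw [show ρ ^ 2 / (B : ℝ) ^ 6 = (ρ / (B : ℝ) ^ 3) ^ 2 by field_simp]
    exact pow_le_pow_left₀ (kRem_nonneg' hα₀0 hα₁0) hk 2
  have e4 : (d + 1) * (c₂ / (B : ℝ) ^ 3) ^ 2 + d * (6 * d + 1) * α₁ ^ 2 / (B : ℝ) ^ 2
      = ((d + 1) * c₂ ^ 2 + d * (6 * d + 1) * c₁ ^ 2) / (B : ℝ) ^ 6 := by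
    rw [hα₁]; field_simp
  unfold kBox
  rw [e4]
  have hP : (0 : ℝ) ≤ d * Fintype.card (T4AveragingDeficitWall.Plane d) := by positivity
  have hdN : (0 : ℝ) ≤ 16 * d * N := by positivity
  rw [show (d * Fintype.card (T4AveragingDeficitWall.Plane d) * (16 * d * N * ((d + 1) * c₂ ^ 2 + d * (6 * d + 1) * c₁ ^ 2) + 2 * ρ ^ 2))
      / (B : ℝ) ^ 6 = d * Fintype.card (T4AveragingDeficitWall.Plane d) * (16 * d * N * (((d + 1) * c₂ ^ 2 + d * (6 * d + 1) * c₁ ^ 2)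
      / (B : ℝ) ^ 6) + 2 * (ρ ^ 2 / (B : ℝ) ^ 6)) by field_simp]
  gcongr

/-- **THE K-DATUM IN `Regular.grad` CURRENCY.**  If the `U(N)`-valued `V` admits around every block base corner
`L^j • q` a local exponential gauge on the cube `box (2L^j + 1) (L^j • q)` (side `≈ 4L^j`: the block, a collar of width
`L^j` for the Caccioppoli cutoff, and two boundary layers) with the printed-TYPE sup radii `c₀/L^j`, `c₁/L^{2j}`,
`c₂/L^{3j}` (`c₀, c₁ ≤ 1/8`), then
`gradFluxSq V ([0, N·L^j)^d) ≤ kReg(d, N_c, c₀, c₁, c₂) · N^d · (L^j)^d / (L^j)^6` — exactly the slot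
`MinimalActionRate.Regular.grad` of row NE3's `SandwichData` (H3) and, through
`blockSites L (periodBox M) = periodBox (L·M)`, the `√gradFluxSq` factor of this row's `dualResidual_torus`. [folklore] -/
theorem gradFluxSq_period_le_scaling [Nonempty n] {V : Site d → Fin d → (Matrix n n ℂ)ˣ} (hV : IsUnitaryCfg V) {L j N : ℕ}
    (hL : 1 ≤ L) {c₀ c₁ c₂ : ℝ} (hc₀ : 0 ≤ c₀) (hc₀' : c₀ ≤ 1 / 8) (hc₁ : 0 ≤ c₁) (hc₁' : c₁ ≤ 1 / 8)
    (hG : ∀ q : Site d, ExpGauge d V (((L ^ j : ℕ) : ℤ) • q) (L ^ j - 1 + L ^ j + 2)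
      (c₀ / ((L ^ j : ℕ) : ℝ)) (c₁ / ((L ^ j : ℕ) : ℝ) ^ 2) (c₂ / ((L ^ j : ℕ) : ℝ) ^ 3)) :
    gradFluxSq V (periodBox (N * L ^ j))
      ≤ kReg d (Fintype.card n) c₀ c₁ c₂ * (N : ℝ) ^ d * ((L : ℝ) ^ j) ^ d / ((L : ℝ) ^ j) ^ 6 := by
  set B : ℕ := L ^ j with hBdef
  have hB : 1 ≤ B := Nat.one_le_pow _ _ hL
  have hB1 : (1 : ℝ) ≤ B := by exact_mod_cast hB
  have hBr : ((L : ℝ) ^ j) = (B : ℝ) := by rw [hBdef]; push_cast; ring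
  have hα₀0 : 0 ≤ c₀ / (B : ℝ) := by positivity
  have hα₁0 : 0 ≤ c₁ / (B : ℝ) ^ 2 := by positivity
  have hα₀' : c₀ / (B : ℝ) ≤ 1 / 8 := (div_le_self hc₀ hB1).trans hc₀'
  have hα₁' : c₁ / (B : ℝ) ^ 2 ≤ 1 / 8 := (div_le_self hc₁ (one_le_pow₀ hB1)).trans hc₁'
  have h := gradFluxSq_period_le hV (N := N) hB hB hα₀0 hα₁0 hα₀' hα₁' hG
  rw [Nat.mul_comm N, hBr]
  refine h.trans ?_
  have hk := kBox_scaling_le d (Fintype.card n) B hB hc₀ hc₀' hc₁ hc₁' (c₂ := c₂)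
  have hside : ((2 * (B - 1 + B + 2) + 1 : ℕ) : ℝ) ≤ 7 * B := by
    have : 2 * (B - 1 + B + 2) + 1 ≤ 7 * B := by omega
    exact_mod_cast this
  have hside' : ((2 * (B - 1 + B + 2) + 1 : ℕ) : ℝ) ^ d ≤ 7 ^ d * (B : ℝ) ^ d := by
    rw [← mul_pow]; exact pow_le_pow_left₀ (by positivity) hside d
  have hK0 := kBox_nonneg d (Fintype.card n) B (c₀ / B) (c₁ / (B : ℝ) ^ 2) (c₂ / (B : ℝ) ^ 3)
  calc (N : ℝ) ^ d * ((2 * (B - 1 + B + 2) + 1 : ℕ) : ℝ) ^ d * kBox d (Fintype.card n) B (c₀ / B) (c₁ / (B : ℝ) ^ 2)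
        (c₂ / (B : ℝ) ^ 3)
      ≤ (N : ℝ) ^ d * (7 ^ d * (B : ℝ) ^ d) * (d * Fintype.card (T4AveragingDeficitWall.Plane d)
          * (16 * d * Fintype.card n * ((d + 1) * c₂ ^ 2 + d * (6 * d + 1) * c₁ ^ 2)
            + 2 * (90 * c₀ * c₁ + 32 * c₁ ^ 2 + 360 * c₀ ^ 3) ^ 2) / (B : ℝ) ^ 6) := by
        gcongr
    _ = kReg d (Fintype.card n) c₀ c₁ c₂ * (N : ℝ) ^ d * (B : ℝ) ^ d / (B : ℝ) ^ 6 := by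
        rw [kReg]; ring

/-- **`Regular` FROM THE LOCAL EXPONENTIAL GAUGES** (row NE3's (H3) slot): unitary, `(N L^j)`-periodic, small field of
radius `b/L^{2j}`, and the local exponential gauges with sup radii `c₀/L^j, c₁/L^{2j}, c₂/L^{3j}` around every block
give `Regular d L N b (kReg d N_c c₀ c₁ c₂) j V`. [folklore] -/
theorem regular_of_expGauge [Nonempty n] {V : Site d → Fin d → (Matrix n n ℂ)ˣ} {L j N : ℕ} (hL : 1 ≤ L) {b c₀ c₁ c₂ : ℝ}
    (hu : IsUnitaryCfg V) (hp : IsPeriodicCfg V ((N * L ^ j : ℕ) : ℤ)) (hs : SmallField V (b / ((L : ℝ) ^ j) ^ 2))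
    (hc₀ : 0 ≤ c₀) (hc₀' : c₀ ≤ 1 / 8) (hc₁ : 0 ≤ c₁) (hc₁' : c₁ ≤ 1 / 8)
    (hG : ∀ q : Site d, ExpGauge d V (((L ^ j : ℕ) : ℤ) • q) (L ^ j - 1 + L ^ j + 2)
      (c₀ / ((L ^ j : ℕ) : ℝ)) (c₁ / ((L ^ j : ℕ) : ℝ) ^ 2) (c₂ / ((L ^ j : ℕ) : ℝ) ^ 3)) :
    Regular d L N b (kReg d (Fintype.card n) c₀ c₁ c₂) j V where
  unitary := hu
  periodic := hp
  small := hs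
  grad := gradFluxSq_period_le_scaling hu hL hc₀ hc₀' hc₁ hc₁' hG

/-- NON-VACUITY: the flat configuration satisfies every hypothesis (all radii `0`), at every level. [folklore] -/
theorem regular_flat [Nonempty n] (L j N : ℕ) (hL : 1 ≤ L) :
    Regular d L N 0 (kReg d (Fintype.card n) 0 0 0) j (fun (_ : Site d) (_ : Fin d) => (1 : (Matrix n n ℂ)ˣ)) := by
  have hG : ∀ q : Site d, ExpGauge d (fun (_ : Site d) (_ : Fin d) => (1 : (Matrix n n ℂ)ˣ)) (((L ^ j : ℕ) : ℤ) • q)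
      (L ^ j - 1 + L ^ j + 2) (0 / ((L ^ j : ℕ) : ℝ)) (0 / ((L ^ j : ℕ) : ℝ) ^ 2) (0 / ((L ^ j : ℕ) : ℝ) ^ 3) := by
    intro q; simp only [zero_div]; exact expGauge_flat _ _
  refine regular_of_expGauge hL (fun _ _ => (unitaryUnits (Matrix n n ℂ)).one_mem) (fun _ _ _ => rfl) ?_ le_rfl (by norm_num)
    le_rfl (by norm_num) hG
  intro x κ κ' _
  simp [hol_flat]


/-! ## §3 The K-slot of this row's `dualResidual_torus`, inhabited -/

/-- **R2ᴱ ON THE TORUS WITH THE K-DATUM SUPPLIED BY LOCAL EXPONENTIAL GAUGES**: under the hypotheses of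
`AveragingDeficitDualResidual.dualResidual_torus` (fine criticality `FineCritical` — a THEOREM for constrained minimisers by
gen 3's `AveragingDeficitFermat` —, periodic small-field `U(N)` data of period `L·M`) and local exponential gauges with
sup radii `α₀, α₁ ≤ 1/8`, `α₂` around the cubes of a block decomposition `L·M = B·N′` of the period,
`L^{d−4}|D_c| ≤ wallConst·[√(N′^d (2B+2M′+3)^d kBox)·dualC2·‖φ‖_{ℓ²} + a²·dualC1·‖φ‖_{ℓ¹}]` — the residual current of
the average against every admissible periodic coarse direction, with NO `ℓ²`-gradient datum left as a hypothesis.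
[folklore] -/
theorem dualResidual_torus_expGauge [Nonempty n] {L : ℕ} (hL : 1 ≤ L) {M : ℕ} (hM : 1 ≤ M)
    {V : Site d → Fin d → (Matrix n n ℂ)ˣ} (hV : IsUnitaryCfg V) (hVP : IsPeriodicCfg V ((L : ℤ) * M)) {a : ℝ} (ha : 0 ≤ a)
    (hsmall : liftSmall d L * a ≤ 1) (hVa : SmallField V a) {Tc : (Site d → Fin d → Matrix n n ℂ) → Prop}
    (hcrit : FineCritical L M V Tc) (φ : Site d → Fin d → Matrix n n ℂ) (hφs : ∀ (y : Site d) (κ : Fin d), φ y κ ∈ skewAdjoint (Matrix n n ℂ))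
    (hφP : ∀ (y : Site d) (j κ : Fin d), φ (y + (M : ℤ) • e j) κ = φ y κ) (hφT : Tc φ) (Φ : Site d → Fin d → Matrix n n ℂ)
    (hΦ : ∀ (y : Site d) (κ : Fin d), Φ ((L : ℤ) • y) κ = φ y κ) {Dc : ℝ}
    (hDc : HasDerivAt (fun s : ℝ => coarseActionOf L (vary (bavg L V) Φ s) (blockWindow L (periodBox M)).1) Dc 0)
    {B N' M' : ℕ} (hB : 1 ≤ B) (hM' : 1 ≤ M') (hBN : L * M = B * N') {α₀ α₁ α₂ : ℝ} (hα₀ : 0 ≤ α₀) (hα₁ : 0 ≤ α₁)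
    (hα₀' : α₀ ≤ 1 / 8) (hα₁' : α₁ ≤ 1 / 8) (hG : ∀ q : Site d, ExpGauge d V ((B : ℤ) • q) (B - 1 + M' + 2) α₀ α₁ α₂) :
    (L : ℝ) ^ ((d : ℤ) - 4) * |Dc|
      ≤ wallConst d L * (Real.sqrt ((N' : ℝ) ^ d * ((2 * (B - 1 + M' + 2) + 1 : ℕ) : ℝ) ^ d
            * kBox d (Fintype.card n) M' α₀ α₁ α₂) * (dualC2 d L * Real.sqrt (coarseSq M φ))
          + a ^ 2 * (dualC1 d L * coarseL1 M φ)) := by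
  have h := dualResidual_torus hL hM hV hVP ha hsmall hVa hcrit φ hφs hφP hφT Φ hΦ hDc
  rw [blockSites_periodBox L M hL, hBN] at h
  have hK := gradFluxSq_period_le hV (N := N') hB hM' hα₀ hα₁ hα₀' hα₁' hG
  have hC2 : 0 ≤ dualC2 d L * Real.sqrt (coarseSq M φ) := by unfold dualC2; positivity
  exact h.trans (mul_le_mul_of_nonneg_left (add_le_add (mul_le_mul_of_nonneg_right (Real.sqrt_le_sqrt hK) hC2) le_rfl)
    (wallConst_nonneg d L))

end

end Summit.QuantumFields.BalabanUV.T4Continuum.AveragingDeficitKDatumTorus
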